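/- Copyright: the b2b-balaban cell (near-miss cell 7), T⁴-continuum fan-out, lineage t4-ne7b-p1 (node U5c COUNT
member).  Released under the licence of the surrounding project. -/
import Summits.QuantumFields.BalabanUV.T4Continuum.Support.CountThresholdExit

/-!
# The late-merger infrared threshold, SHAPE-MAP FREE (owner repair for the T⁴ quantifier order)

Summits-side support leaf of the T⁴-continuum cell (rung (B)+1 on a FINITE torus only; NOT infinite volume, NOT the
mass gap, NOT the Clay statement; NOT a proof of the spine estimate NE7b).  Lineage `t4-ne7b-p1` (generation 22, row
NE7b owner).  [folklore] bookkeeping over the cell's own chain; nothing is quoted from print, nothing printed is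
asserted; no `[cite:]` tag.

WHY.  After ruling R-OWNER-22-1 the NE7b COUNT assembly targets the TREE-count exit
`CountThresholdExit.relWeightBound_lateMergers_of_irThreshold (sh : ε → PEv)`, whose infrared-smallness binder reads
`irThresholdTH sh C L r β₀ D ≤ log g_K⁻²` with the NAMED threshold `irThresholdTH sh …` = `Classical.choose` of
`LateMergers.exists_irThresholdTH sh …` — formally a function of the SHAPE MAP `sh`, i.e. of the tag type of the
genealogies.  In the T⁴ targets' quantifier order («∃ g₁ > 0, ∀ g ≤ g₁, ∀ ε, ∀ tuned g₀, ∀ K, ∀ terms …») the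
renormalised-coupling threshold must be chosen BEFORE the histories and their tag types; a threshold depending on `sh`
could not be (unless every assembly froze ONE universal tag type).  The landed proof of `exists_irThresholdTH` in fact
takes its witness from the shape-free `LateMergers.exists_payThresholdH C … D` and only afterwards specialises to `sh`.
THIS LEAF names THAT witness: `irThresholdH C L r β₀ D` (constants and horizon ONLY), proves the late-merger `Banking`
for EVERY shape map from it (`bankingTH_of_irThresholdH`), and re-derives the exit with the shape-free binder
(`relWeightBound_lateMergers_of_irThresholdH`): the SAME conclusion, one binder changed.  Sockets and assemblies over the
TH exit (`HistorySocketTH`, S12) can switch `hir` to the shape-free form by replacing one lemma name.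

HONEST.  Quantifier-order bookkeeping of OUR chain; no estimate of Bałaban's.  NE7b NOT proved.  HONEST DEPENDENCY
(cell): continuum YM on T⁴ ⇐ BetaPertH ∧ nine spine estimates (0/9 proved); BetaPertH ⇐ (D1) ∧ (D4) ∧ CAP+tail.
-/

open Finset
open Literature.MathematicalPhysics.QuantumFieldTheory.Balaban1983to89
open T4PersistenceDictionary T4PersistentHistoryCount T4BankedInduction T4PrintedShapeBanking
open T4WeightBudget T4GlobalDenominator T4LiveClassFibration T4LiveStructureGas T4LiveGasToTerms T4RecordPriceSeam
open T4PartnerMultiplicity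
open Summit.QuantumFields.BalabanUV.T4Continuum.CountThresholdUniform
open T4BranchingRecordsGas T4TaggedShapeBanking T4CanonicalMenus T4CountHorizon T4MatchingClosureSocket
open Summit.QuantumFields.BalabanUV.T4Continuum.LateMergers
open Summit.QuantumFields.BalabanUV.T4Continuum.CountThresholdExit

namespace Summit.QuantumFields.BalabanUV.T4Continuum.CountThresholdShapeFree

noncomputable section

/-! ## §1 The shape-free threshold and the banking for every shape map -/

section Threshold

variable {ε : Type*} [DecidableEq ε]

/-- **THE LATE-MERGER THRESHOLD, SHAPE-MAP FREE**: the witness of `LateMergers.exists_payThresholdH` chosen once — a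
function of `(C, L, r, β₀, D)` ONLY (`0` off the side conditions, where it is never used). [folklore] -/
def irThresholdH (C : T4PrintedShapeBanking.Consts) (L r : ℕ) (β₀ : ℝ) (D : ℕ) : ℝ :=
  haveI := Classical.dec (ThresholdOK C L r β₀)
  if h : ThresholdOK C L r β₀ then
    Classical.choose (exists_payThresholdH C h.valid h.a_pos h.A₀_pos h.one_le_L h.β₀_nonneg h.rq_lt D)
  else 0

/-- **ITS SPECIFICATION, FOR EVERY SHAPE MAP**: along every run of the typed flow with
`irThresholdH C L r β₀ D ≤ log g_K⁻²`, the late-merger data of ANY `sh : ε → PEv` inhabit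
`Banking (ConsistentTH sh C K R D) (padW (dictWT sh R C.n₁) D) …`. [folklore] -/
theorem bankingTH_of_irThresholdH (sh : ε → PEv) {C : T4PrintedShapeBanking.Consts} {L r : ℕ} {β₀ : ℝ}
    (h : ThresholdOK C L r β₀) (D K : ℕ) (R : ℕ → ℕ) (g : ℕ → ℝ) (β' : ℝ) (h27 : B14.FlowIneq27 g β' β₀ C.p₀ K)
    (h29 : B14FlowStep.FlowIneq29 R g L β' β₀ K) (hR : ∀ s, s ≤ K → B14.IsRj L r (g s) (R s))
    (hx1 : ∀ s, s ≤ K → 1 ≤ Real.log ((g s) ^ 2)⁻¹) (hir : irThresholdH C L r β₀ D ≤ Real.log ((g K) ^ 2)⁻¹) :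
    Banking (ConsistentTH sh C K R D) (padW (dictWT sh R C.n₁) D) (costT sh C K R) (credit C g ∘ sh)
      (fun e => C.κ₁ * ((bankW sh R C.n₁ D e : ℕ) : ℝ) + Emarg C (sh e)) (reserve C g ∘ sh) (extnT sh C K R) := by
  have hdef : irThresholdH C L r β₀ D =
      Classical.choose (exists_payThresholdH C h.valid h.a_pos h.A₀_pos h.one_le_L h.β₀_nonneg h.rq_lt D) := by
    unfold irThresholdH; rw [dif_pos h]
  have hspec :=
    Classical.choose_spec (exists_payThresholdH C h.valid h.a_pos h.A₀_pos h.one_le_L h.β₀_nonneg h.rq_lt D)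
  obtain ⟨Hb, Hr, Hm⟩ := hspec K R g β' h27 hR hx1 (hdef ▸ hir)
  exact banking_lateMergers h.valid h29 h.one_le_L (one_le_R hR h.one_le_L) Hb Hr Hm

end Threshold

/-! ## §2 The [CONV-D] exit with the shape-free infrared binder -/

section Exit

variable {ε : Type*} [DecidableEq ε]
variable {γ κ ι : Type*} [DecidableEq γ] [DecidableEq κ] {l₀ : ℝ} {K₀ : ℕ} {π : ℕ → ι → κ} {T : ℕ → Finset ι}
  {A A' : ℕ → ℝ → ι → ℝ} {Bad' : ℕ → ℝ → Finset κ} {dead dead' : ℕ → ℝ → ι → ℝ} {F Rf F' Rf' : ℕ → κ → ℝ}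
  {nlow nup mlow mup : ℕ → ℝ → ℝ} {Cn : ℝ}

/-- **THE [CONV-D] EXIT, SHAPE-FREE THRESHOLD.**  `CountThresholdExit.relWeightBound_lateMergers_of_irThreshold` with
the ONE binder `hir` re-stated over `irThresholdH C L r β₀ D` (constants and horizon only); everything else VERBATIM,
conclusion unchanged. [folklore] -/
theorem relWeightBound_lateMergers_of_irThresholdH (sh : ε → PEv) {C : T4PrintedShapeBanking.Consts} {L r : ℕ}
    {β₀ : ℝ} (h : ThresholdOK C L r β₀) (hμ₀ : 0 < C.μ)
    (Cell : ℕ → ℕ → Finset γ) {V Λ : ℝ} (hV : 0 ≤ V) (hΛ : 0 < Λ)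
    (hcell : ∀ K a, ((Cell K a).card : ℝ) ≤ V * Λ ^ a) (Dcap Ncap : ℕ → ℕ)
    (jstar : ℕ → ℕ) (hj : ∀ K, jstar K ≤ K) {c : ℝ} (hc : 0 < c)
    (hfrac : ∀ K : ℕ, c * K ≤ ((K - jstar K : ℕ) : ℝ)) (D : ℕ) {Δ : ℝ} (hΔ : 1 ≤ Δ)
    (hA : Regeneration l₀ π T A Bad' dead F Rf nlow nup Cn K₀)
    (hA' : Regeneration l₀ π T A' Bad' dead' F' Rf' mlow mup Cn K₀) (hCn : 0 ≤ Cn)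
    (R : ℕ → ℕ → ℕ) (g : ℕ → ℕ → ℝ) (β' : ℕ → ℝ)
    (h27 : ∀ K, K₀ ≤ K → B14.FlowIneq27 (g K) (β' K) β₀ C.p₀ K)
    (h29 : ∀ K, K₀ ≤ K → B14FlowStep.FlowIneq29 (R K) (g K) L (β' K) β₀ K)
    (hR : ∀ K, K₀ ≤ K → ∀ s, s ≤ K → B14.IsRj L r (g K s) (R K s))
    (hx1 : ∀ K, K₀ ≤ K → ∀ s, s ≤ K → 1 ≤ Real.log ((g K s) ^ 2)⁻¹)
    (hir : ∀ K, K₀ ≤ K → irThresholdH C L r β₀ D ≤ Real.log ((g K K) ^ 2)⁻¹)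
    (hP : ∀ K s, 0 ≤ p0Profile C.A₀ C.p₀ (g K s))
    {ηplus : ℝ} (hηplus : 0 ≤ ηplus) (hr : Λ * Real.exp (ηplus - C.κ₁) < 1)
    {Λ' : ℝ} (hΛ0 : 0 ≤ Λ') (h1 : Λ' * Real.exp (-C.κ₁) * Real.exp ηplus < 1)
    (hx : (Real.exp (-C.E₀) + Real.exp (-C.E₀) * birthMass C *
          (Λ' * Real.exp (-C.κ₁) / (1 - Λ' * Real.exp (-C.κ₁) * Real.exp ηplus))) * Real.exp ηplus ≤
        Real.exp ηplus - 1)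
    (y : ℕ → ℕ → γ → Gen PEv → ℝ)
    (hy0 : ∀ K, ∀ j ≤ K, ∀ z ∈ Cell K (K - j), ∀ G ∈ canonFam Dcap Ncap K j, 0 ≤ y K j z G)
    (hlabTH : ∀ K, K₀ ≤ K → ∀ j ≤ K, ∀ z ∈ Cell K (K - j), ∀ G ∈ canonFam Dcap Ncap K j,
      y K j z G ≤ 0 ∨ ∃ G' : Gen ε, ConsistentTH sh C K (R K) D G' ∧ FreshT G' ∧
        K - D < G'.reach (dictWT sh (R K) C.n₁) ∧ relabel (shape ∘ sh) G' = G ∧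
        y K j z G ≤ Δ * (Λ' ^ partnerAges (PEv.step ∘ sh) G' * (Real.exp (-credits (credit C (g K) ∘ sh) G') *
          Real.exp (lifeCost (padW (dictWT sh (R K) C.n₁) D) (costT sh C K (R K)) G'))))
    (str : ℕ → κ → Finset (BSlot γ PEv))
    (hinj : ∀ K t, |t| ≤ l₀ → K₀ ≤ K → Set.InjOn (str K) (Bad' K t))
    (hstr : ∀ K t, |t| ≤ l₀ → K₀ ≤ K → ∀ c ∈ Bad' K t,
      str K c ⊆ bliveSlots Cell (canonFam Dcap Ncap) K ∧
        ∃ o ∈ boldSlots Cell (canonFam Dcap Ncap) jstar K, o ∈ str K c)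
    (hF : ∀ K t, |t| ≤ l₀ → K₀ ≤ K → ∀ c ∈ Bad' K t, F K c * Rf K c ≤ famWeight (bslotPrice (y K)) (str K c))
    (hF' : ∀ K t, |t| ≤ l₀ → K₀ ≤ K → ∀ c ∈ Bad' K t, F' K c * Rf' K c ≤ famWeight (bslotPrice (y K)) (str K c)) :
    ∃ K₁, K₀ ≤ K₁ ∧ RelWeightBound l₀ T A A' (fun K t => if K₁ ≤ K then badOfClass π T Bad' K t else ∅)
      (Set.indicator {K | K₁ ≤ K}
        (fun K => Cn * recordsBudget (Δ * Real.exp (C.κ₁ * (D : ℝ)) * birthMass C) C.κ₁ V Λ ηplus jstar K)) :=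
  exists_relWeightBound_of_bankingTH sh h.valid.κ₁_nonneg R g D
    (fun K hK => bankingTH_of_irThresholdH sh h D K (R K) (g K) (β' K) (h27 K hK) (h29 K hK) (hR K hK) (hx1 K hK)
      (hir K hK))
    Cell hV hΛ hcell (fun _ => menuRen) (fun _ => menuMer) (dictB Dcap) (dictB Dcap) Ncap (fun _ t => menuMer_step t)
    (fun K j => sum_dictB_rho_le hμ₀ Dcap K j (hP K j)) (fun _ t => (sum_menuRen_eta C t).le)
    (fun _ t => (sum_menuMer_eta C t).le) (fun K s => sum_dictB_eta_le hμ₀ Dcap K s) hηplus hr hΛ0 h1 hx jstar hj hc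
    hfrac hΔ y hy0 hlabTH str hinj hstr hA hA' hF hF' hCn

end Exit

end

end Summit.QuantumFields.BalabanUV.T4Continuum.CountThresholdShapeFree
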